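import Summits.BirchSwinnertonDyer.BirchSwinnertonDyer.Theorems.PrintCf2RamifiedOffTYZEvenOmegaRowThree
import Summits.BirchSwinnertonDyer.BirchSwinnertonDyer.Theorems.PrintCf2RamifiedOffTYZEvenOmegaRowTwo
import Summits.BirchSwinnertonDyer.BirchSwinnertonDyer.Theorems.PrintCf2RamifiedOffTYZEvenOmegaDefs
import Summits.BirchSwinnertonDyer.BirchSwinnertonDyer.Theorems.PrintCf2RamifiedOffTYZMoverSumBlocksSixAll
import Literature.NumberTheory.EllipticCurves.Smith2016.CongruentNumberGenusSumSixDecompositions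
import HarnessLib

/-!
# Route `PrintCf2`, crux stmt-BirchSwinnertonDyer-20509 `RamifiedOffTYZOfFacts` — THE EVEN Ω-IDENTITY: DICTIONARY (census coordinates ↔ forest calculus), I
# (cell `bsd-print-cf2`, LEAD of 20509 g14, line `offtyz-v7`, cycle 15; kernel helpers `--supports stmt-BirchSwinnertonDyer-20509`)

The ingredients of LEAD g13's `EvenOmegaDefs.evenSquareFormMatrix` / `evenOmegaFormMatrix` (crux workfile `Lines/offtyz_v7_EvenOmega.lean`) are written
in CENSUS COORDINATES (sub-tuples `blockPrimes p S`, kernel sums, residues `∏_S pᵢ mod 8`); the abstract row identities of `…EvenOmegaRowTwo/Three/Four`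
speak the tree's forest calculus (`lap`, `bigN`, `qwt`, `fwt`, `setExp`, `sconv`, `spoint` on the ambient index type `Fin k`).  This file is the
first half of the dictionary (`Lines/offtyz_v7_EvenOmegaProof.md` §1), for a tuple of distinct odd primes `p`, `a i j = legendreMatrix p i j`,
`t = ((−1/pᵢ)₊)`, `z = ((2/pᵢ)₊)`:
* §1 residues ↔ parities: `∏_X pᵢ mod 8 ∈ {1,3,5,7} ↔ (Σ_X t, Σ_X z) ∈ {(0,0),(1,1),(0,1),(1,0)}` (`prod_mod_eight_iff_sums`);
* §2 `blockWeightOdd p X = det bigN a X t z 0` (all `X`; the uniform dictionary of `…QFormDualCofactor`) and `blockWeightEven p X = det bigN a X t z z`;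
* §3 the kernel sums of `N_S = [[A_S + D₋₂, z_S],[0,0]]` IN EVERY REGIME: `kerSum(N)_{inr} = det B`, `kerSum(N)_{inl x} = det(B[col x ← c])`
  (generic `𝔽₂` linear algebra: line kernel ⟹ adjugate column, LEAD g9/g13; larger kernel ⟹ both sides vanish), hence
  `blockKappaSixInf p S = det(lap a S (t+z))` and `blockKappaSix p S j = det((lap a S (t+z))[col j ← z·1_S])` (`j ∈ S`).
Pure linear algebra over `𝔽₂` + quadratic reciprocity; no `sorry`.  BSD is not proved by any of this; no class is closed.

References: [cite: HeathBrown1994SelmerCongruentII, Appendix (Monsky), typescript p. 39 L10 – p. 41 L36]; [cite: HornJohnson2013, §0.8.2];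
[cite: Stevenhagen1995RedeiMatrices, §2]; [cite: Chaiken1982, §2]; crux notes `Lines/offtyz_v7_EvenOmegaProof.md` §1.
-/

noncomputable section

open scoped Classical

namespace Summit.BirchSwinnertonDyer.PrintCf2.QFormForest

open Matrix Finset Literature.LinearAlgebra.Matrix Literature.Combinatorics.Enumerative
open Literature.NumberTheory.EllipticCurves.Smith2016
open Literature.NumberTheory.EllipticCurves.HeathBrown1994 Literature.NumberTheory.EllipticCurves.HeathBrown1994.Families
open Literature.NumberTheory.EllipticCurves.MonskySelmerParity
open Summit.BirchSwinnertonDyer.PrintCf2.QForm Summit.BirchSwinnertonDyer.PrintCf2.EvenOmegaDefs Summit.BirchSwinnertonDyer.PrintCf2.MoverAssembly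

set_option autoImplicit false

section Dictionary

variable {k : ℕ} (p : Fin k → ℕ) (hp : ∀ i, (p i).Prime) (hodd : ∀ i, Odd (p i)) (hinj : Function.Injective p)

/-! ## §1 Residues ↔ parities -/

include hp hodd in
/-- **`∏_X pᵢ mod 8` ↔ `(Σ_X t, Σ_X z)`**: `≡ 1 ↔ (0,0)`, `≡ 3 ↔ (1,1)`, `≡ 5 ↔ (0,1)`, `≡ 7 ↔ (1,0)`, and `≡ 1 (mod 4) ↔ Σ_X t = 0`
(`tᵢ = (−1/pᵢ)₊`, `zᵢ = (2/pᵢ)₊`). [cite: HeathBrown1994SelmerCongruentII, Appendix (Monsky), typescript p. 39 L36–L37] [cite: IrelandRosen1990, Ch. 5 §1] -/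
theorem prod_mod_eight_iff_sums (X : Finset (Fin k)) :
    ((∏ i ∈ X, p i) % 8 = 1 ↔ (∑ i ∈ X, addLegendreSym (-1) (p i) = 0 ∧ ∑ i ∈ X, addLegendreSym 2 (p i) = 0)) ∧
    ((∏ i ∈ X, p i) % 8 = 3 ↔ (∑ i ∈ X, addLegendreSym (-1) (p i) = 1 ∧ ∑ i ∈ X, addLegendreSym 2 (p i) = 1)) ∧
    ((∏ i ∈ X, p i) % 8 = 5 ↔ (∑ i ∈ X, addLegendreSym (-1) (p i) = 0 ∧ ∑ i ∈ X, addLegendreSym 2 (p i) = 1)) ∧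
    ((∏ i ∈ X, p i) % 8 = 7 ↔ (∑ i ∈ X, addLegendreSym (-1) (p i) = 1 ∧ ∑ i ∈ X, addLegendreSym 2 (p i) = 0)) ∧
    ((∏ i ∈ X, p i) % 4 = 1 ↔ ∑ i ∈ X, addLegendreSym (-1) (p i) = 0) := by
  have h2 := blockProd_mod_two p hp hodd X
  have ht := sum_addLegendreSym_neg_one_block_eq p hp hodd X
  have hz := sum_addLegendreSym_two_eq X p (fun i _ => Nat.odd_iff.mp (hodd i))
  set n := ∏ i ∈ X, p i with hn
  have h8 : n % 8 = 1 ∨ n % 8 = 3 ∨ n % 8 = 5 ∨ n % 8 = 7 := by omega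
  rcases h8 with h | h | h | h
  · have h4 : n % 4 = 1 := by omega
    rw [if_pos h4] at ht
    rw [if_neg (by omega)] at hz
    rw [ht, hz, h, h4]; decide
  · have h4 : ¬ n % 4 = 1 := by omega
    rw [if_neg h4] at ht
    rw [if_pos (Or.inl h)] at hz
    rw [ht, hz, h, show n % 4 = 3 by omega]; decide
  · have h4 : n % 4 = 1 := by omega
    rw [if_pos h4] at ht
    rw [if_pos (Or.inr h)] at hz
    rw [ht, hz, h, h4]; decide
  · have h4 : ¬ n % 4 = 1 := by omega
    rw [if_neg h4] at ht
    rw [if_neg (by omega)] at hz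
    rw [ht, hz, h, show n % 4 = 3 by omega]; decide

/-! ## §2 The block weights -/

include hp hodd hinj in
/-- **`blockWeightOdd p X = det bigN a X t z 0`** for every sub-block (both parities): the uniform dictionary `coblockWeight_eq_det_bigN_zero_root`
read at `S = Xᶜ`. [cite: HeathBrown1994SelmerCongruentII, Appendix (Monsky), typescript p. 39 L27–L33] [cite: Chaiken1982, §2] -/
theorem blockWeightOdd_eq_det_bigN (X : Finset (Fin k)) :
    blockWeightOdd p X =
      (bigN (fun i j => legendreMatrix p i j) X (fun i => addLegendreSym (-1) (p i)) (fun i => addLegendreSym 2 (p i)) 0).det := by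
  have hp2 : ∀ i, p i ≠ 2 := ne_two_of_odd p hodd
  have h := coblockWeight_eq_det_bigN_zero_root p hp hp2 hinj Xᶜ
  rw [compl_compl] at h
  rw [← h, blockWeightOdd, coblockWeight, coblockMonsky, compl_compl]

/-- **`blockWeightEven p X = det bigN a X t z z`**: Monsky's even matrix of the sub-tuple is congruent to its doubled forest matrix
(`det_monskyMatrixEven_eq_det_bigN`), re-indexed to the ambient block. [cite: HeathBrown1994SelmerCongruentII, Appendix (Monsky), typescript p. 41 L20–L36] [cite: Chaiken1982, §2] -/
theorem blockWeightEven_eq_det_bigN (X : Finset (Fin k)) :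
    blockWeightEven p X =
      (bigN (fun i j => legendreMatrix p i j) X (fun i => addLegendreSym (-1) (p i)) (fun i => addLegendreSym 2 (p i))
        (fun i => addLegendreSym 2 (p i))).det := by
  set e := (X.orderIsoOfFin rfl).toEquiv with he
  set q : Fin X.card → ℕ := blockPrimes p X with hq
  have hqe : ∀ t, q t = p (e t : Fin k) := fun t => rfl
  rw [blockWeightEven, ← hq, det_monskyMatrixEven_eq_det_bigN q, det_bigN_eq_det_bigN_reindex _ X _ _ _ e]
  congr 1
  refine bigN_congr_offdiag (fun i j hij => ?_) _ _ _ _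
  rw [Families.legendreMatrix_apply_of_ne q hij, Families.legendreMatrix_apply_of_ne p (fun h => hij (e.injective (Subtype.ext h))), hqe, hqe]

/-! ## §3 The kernel sums of `[[B, c],[0, 0]]` in every regime -/

section KernelSums

variable {m : ℕ} (B : Matrix (Fin m) (Fin m) (ZMod 2)) (c : Fin m → ZMod 2)

/-- **`kerSum([[B,c],[0,0]])` is the `inr`-column of the adjugate, or everything vanishes.**  If `#ker = 2` the kernel line is the adjugate
column of the zero row (`kerSum_eq_adjugate_col_of_row_zero`); otherwise `kerSum = 0` and a non-trivial dependency `w` of the rows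
(`wᵀB = 0`, `w·c = 0`) kills `det B` and every `det(B[col x ← c])`. [cite: HornJohnson2013, §0.8.2] [cite: Stevenhagen1995RedeiMatrices, §2] -/
theorem kerSum_fromBlocks_eq (x : Fin m ⊕ Unit) :
    kerSum (fromBlocks B (Matrix.of fun j (_ : Unit) => c j) (0 : Matrix Unit (Fin m) (ZMod 2)) (0 : Matrix Unit Unit (ZMod 2))) x =
      Sum.elim (fun x => (B.updateCol x c).det) (fun _ => B.det) x := by
  set N := fromBlocks B (Matrix.of fun j (_ : Unit) => c j) (0 : Matrix Unit (Fin m) (ZMod 2)) (0 : Matrix Unit Unit (ZMod 2)) with hN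
  have hNrow : ∀ u, N (Sum.inr u) = 0 := fun u => by
    funext cc; rcases cc with i | u'
    · simp only [hN, Matrix.fromBlocks_apply₂₁, Matrix.zero_apply, Pi.zero_apply]
    · simp only [hN, Matrix.fromBlocks_apply₂₂, Matrix.zero_apply, Pi.zero_apply]
  by_cases hcard : Fintype.card {v : Fin m ⊕ Unit → ZMod 2 // N *ᵥ v = 0} = 2
  · rw [kerSum_eq_adjugate_col_of_row_zero N (r₀ := Sum.inr ()) (fun j => congrFun (hNrow ()) j) hcard]
    rcases x with x | u
    · exact adjugate_fromBlocks_col_inl_inr B c x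
    · rw [Subsingleton.elim u ()]; exact adjugate_fromBlocks_col_inr_inr B c
  · rw [kerSum_eq_zero_of_card_ne_two N hcard, Pi.zero_apply]
    obtain ⟨w, hw0, hw⟩ := exists_sum_smul_row_eq_zero N hNrow hcard
    have hwB : w ᵥ* B = 0 := by
      funext i
      have h := congr_fun hw (Sum.inl i)
      rw [Finset.sum_apply, Pi.zero_apply] at h
      simp only [Pi.smul_apply, smul_eq_mul, hN, Matrix.fromBlocks_apply₁₁] at h
      rw [Pi.zero_apply, ← h, vecMul, dotProduct]
    have hwz : ∑ j, w j * c j = 0 := by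
      have h := congr_fun hw (Sum.inr ())
      rw [Finset.sum_apply, Pi.zero_apply] at h
      simp only [Pi.smul_apply, smul_eq_mul, hN, Matrix.fromBlocks_apply₁₂, Matrix.of_apply] at h
      exact h
    symm
    rcases x with x | u
    · refine Matrix.exists_vecMul_eq_zero_iff.mp ⟨w, hw0, ?_⟩
      funext i
      rw [vecMul, dotProduct, Pi.zero_apply]
      by_cases hix : i = x
      · subst hix; simp only [updateCol_self]; exact hwz
      · simp only [updateCol_ne hix]
        have := congr_fun hwB i
        rw [vecMul, dotProduct, Pi.zero_apply] at this
        exact this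
    · exact Matrix.exists_vecMul_eq_zero_iff.mp ⟨w, hw0, hwB⟩

end KernelSums

include hp hodd in
/-- **`κ^S_∞ = det(A_S + D₋₂(S)) = det(lap a S (t+z))`** (`blockKappaSixInf`, every regime).
[cite: HeathBrown1994SelmerCongruentII, Appendix (Monsky), typescript p. 41 L20–L36] [cite: Stevenhagen1995RedeiMatrices, §2] -/
theorem blockKappaSixInf_eq_det_lap (S : Finset (Fin k)) :
    blockKappaSixInf p S = (lap (fun i j => legendreMatrix p i j) S (fun i => addLegendreSym (-1) (p i) + addLegendreSym 2 (p i))).det := by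
  have hp2 : ∀ i, p i ≠ 2 := ne_two_of_odd p hodd
  rw [blockKappaSixInf, blockSixMatrix, kerSum_fromBlocks_eq, Sum.elim_inr, det_lap_eq_det_block_neg_two p hp hp2 S]
  rfl

include hp hodd in
/-- **Census coordinates of the Cramer determinant with the `z`-column**: for `j ∈ S`,
`det((lap a S (t+z))[col j ← z·1_S]) = det((A_S + D₋₂(S))[col j ← z_S])` on `Fin #S`. [cite: HeathBrown1994SelmerCongruentII, Appendix (Monsky), typescript p. 39 L10–L26]
[cite: IrelandRosen1990, Ch. 5 §1 Prop. 5.1.2] -/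
theorem det_updateCol_lap_two_eq_det_updateCol_block {S : Finset (Fin k)} {j : Fin k} (hj : j ∈ S) :
    ((lap (fun i j => legendreMatrix p i j) S (fun i => addLegendreSym (-1) (p i) + addLegendreSym 2 (p i))).updateCol j
        (fun r => if r ∈ S then addLegendreSym 2 (p r) else 0)).det =
      ((blockLegendreMatrix p S + legendreDiagonal (blockPrimes p S) (-2)).updateCol ((S.orderIsoOfFin rfl).symm ⟨j, hj⟩)
        (fun x => addLegendreSym 2 (blockPrimes p S x))).det := by
  have hp2 : ∀ i, p i ≠ 2 := ne_two_of_odd p hodd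
  set e := (S.orderIsoOfFin rfl).toEquiv with he
  rw [det_updateCol_lap_eq_reindex _ _ _ hj e]
  congr 1
  have hmat : lap (fun x y => legendreMatrix p (e x : Fin k) (e y : Fin k)) (univ : Finset (Fin S.card))
      (fun x => addLegendreSym (-1) (p (e x : Fin k)) + addLegendreSym 2 (p (e x : Fin k))) =
      blockLegendreMatrix p S + legendreDiagonal (blockPrimes p S) (-2) := by
    ext x y
    rw [lap_apply, Matrix.add_apply, blockLegendreMatrix, legendreDiagonal, diagonal_apply]
    simp only [mem_univ, and_self, if_true]
    have hq : ∀ x, blockPrimes p S x = p (e x : Fin k) := fun x => rfl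
    by_cases hxy : x = y
    · subst hxy
      rw [if_pos rfl, if_pos rfl, Families.legendreMatrix_apply_self, hq,
        Literature.NumberTheory.EllipticCurves.CongruentNumberOddMonskySelmer.addLegendreSym_neg_two (hp _) (hp2 _)]
      have hsum : ∑ y ∈ univ.erase x, legendreMatrix p (e x : Fin k) (e y : Fin k) =
          ∑ y ∈ univ.erase x, legendreMatrix (blockPrimes p S) x y := by
        refine sum_congr rfl fun y hy => ?_
        rw [Families.legendreMatrix_apply_of_ne p (fun h => (ne_of_mem_erase hy).symm (e.injective (Subtype.ext h))),
          Families.legendreMatrix_apply_of_ne (blockPrimes p S) (ne_of_mem_erase hy).symm, hq, hq]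
      rw [hsum]; ring
    · rw [if_neg hxy, if_neg hxy, add_zero,
        Families.legendreMatrix_apply_of_ne p (fun h => hxy (e.injective (Subtype.ext h))),
        Families.legendreMatrix_apply_of_ne (blockPrimes p S) hxy, hq, hq]
  rw [hmat]
  rfl

include hp hodd in
/-- **`κ^S_j = det((lap a S (t+z))[col j ← z·1_S])`** for `j ∈ S` (`blockKappaSix`, every regime; Cramer's rule on the kernel of `N_S`), and `0`
for `j ∉ S`. [cite: HeathBrown1994SelmerCongruentII, Appendix (Monsky), typescript p. 41 L20–L36] [cite: HornJohnson2013, §0.8.2] -/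
theorem blockKappaSix_eq_det_updateCol (S : Finset (Fin k)) (j : Fin k) :
    blockKappaSix p S j = if j ∈ S then ((lap (fun i j => legendreMatrix p i j) S (fun i => addLegendreSym (-1) (p i) + addLegendreSym 2 (p i))).updateCol j
        (fun r => if r ∈ S then addLegendreSym 2 (p r) else 0)).det else 0 := by
  by_cases hj : j ∈ S
  · rw [if_pos hj, blockKappaSix, dif_pos hj, blockSixMatrix, kerSum_fromBlocks_eq, Sum.elim_inl,
      det_updateCol_lap_two_eq_det_updateCol_block p hp hodd hj]
    rfl
  · rw [if_neg hj, blockKappaSix, dif_neg hj]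

end Dictionary

end Summit.BirchSwinnertonDyer.PrintCf2.QFormForest

end
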